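import Mathlib
import Summits.RiemannHypothesis.RiemannHypothesis.Theorems.IntegerScrewPrimeRangeProducts
import Literature.NumberTheory.LFunctions.MertensTail
import HarnessLib

/-!
# Route `IntegerScrew` — the prime sums `Σ_{2≤y≤R} log(minFac y)/y` and the root-flow energy `E_R`
# (the analytic half of PROPOSITION K, CONTINUUM-LIMIT §24.11, §26.6; also the `α`-energy of PROP. K″, §27.2)

The root flow of PROP. K (`IntegerScrewRootFlow.root_functional_sq_le`) has the explicit energy
`E_R = Σ_{2≤y≤R} π_y²/(y·log minFac y)`, `π_y = Π_{q ≤ minFac y}(1 − 1/q)⁻¹ ≤ e⁵·log minFac y`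
(`IntegerScrewPrimeRangeProducts.prod_primesBelow_succ_inv_le`).  This file bounds it by elementary prime sums
(fibrewise over `q = minFac y` with `sum_minFac_fibre_le`, then the tree's `Σ_{p≤R} log p/p ≤ log R + log 4` and
`Σ_{p≤R} 1/p ≤ log log R + 4` of `Literature.NumberTheory.LFunctions.MertensTail`):

* **`sum_log_minFac_div_le`** — `Σ_{2≤y≤R} log(minFac y)/y ≤ log R + log 4 + e⁵·log(R+1)·(log log R + 4)` (`R ≥ 2`);
* **`rootEnergy_le`** — `E_R ≤ e¹⁰·(log R + log 4 + e⁵·log(R+1)·(log log R + 4))`.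

RH-free, elementary (no flow, no `g`: pure prime sums).  Nothing in this file bears on the truth of RH.
References: CONTINUUM-LIMIT §24.11, §27.2 (rh-explicit A6-PIVOT); M. Suzuki, J. Lond. Math. Soc. (2) 108 (2023)
1448–1487 [Suzuki2023] for the screw matrices this serves.
-/

noncomputable section

set_option linter.dupNamespace false -- D-0017: `Summit.<S>.<S>.…` is the designed namespace

namespace Summit.RiemannHypothesis.RiemannHypothesis.Theorems.IntegerScrew

open Finset Real

/-- The finite Euler product is `≥ 1` (copy of `IntegerScrewWalkPoincareMertens.one_le_prod_primesBelow_inv`, whose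
olean was unavailable at filing). -/
private theorem one_le_prod_primesBelow_inv' (N : ℕ) : 1 ≤ ∏ p ∈ N.primesBelow, (1 - 1 / (p : ℝ))⁻¹ := by
  rw [← Finset.prod_const_one (s := N.primesBelow)]
  refine Finset.prod_le_prod (fun _ _ => zero_le_one) fun p hp => ?_
  have hp2 : (2 : ℝ) ≤ p := by exact_mod_cast (Nat.mem_primesBelow.1 hp).2.two_le
  have h1 : 0 < 1 - 1 / (p : ℝ) := by
    rw [sub_pos, div_lt_one (by linarith)]; linarith
  have h2 : 1 - 1 / (p : ℝ) ≤ 1 := by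
    have : 0 ≤ 1 / (p : ℝ) := by positivity
    linarith
  simpa using (one_le_inv₀ h1).2 h2

/-! ### The sum `Σ_{2≤y≤R} log(minFac y)/y` and the energy `E_R` -/

/-- `Σ_{2≤y≤R} log(minFac y)/y ≤ log R + log 4 + e⁵·log(R+1)·(log log R + 4)` for `R ≥ 2`. -/
theorem sum_log_minFac_div_le {R : ℕ} (hR : 2 ≤ R) :
    ∑ y ∈ Icc 2 R, Real.log y.minFac / y ≤
      Real.log R + Real.log 4 + Real.exp 5 * Real.log ((R : ℝ) + 1) * (Real.log (Real.log R) + 4) := by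
  set Pr := (Icc 2 R).filter Nat.Prime with hPr
  -- fibrewise over q = minFac y
  have hmaps : ∀ y ∈ Icc 2 R, y.minFac ∈ Pr := by
    intro y hy
    have hy' := Finset.mem_Icc.1 hy
    have hp : y.minFac.Prime := Nat.minFac_prime (by omega)
    exact Finset.mem_filter.2 ⟨Finset.mem_Icc.2 ⟨hp.two_le, (Nat.minFac_le (by omega)).trans hy'.2⟩, hp⟩
  rw [← Finset.sum_fiberwise_of_maps_to hmaps]
  -- each fibre: Σ_{minFac y = q} log q/y ≤ log q/q + e⁵ log(R+1)/q
  have hR1 : (0 : ℝ) ≤ Real.log ((R : ℝ) + 1) := Real.log_nonneg (by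
    have : (2 : ℝ) ≤ R := by exact_mod_cast hR
    linarith)
  have hfib : ∀ q ∈ Pr, ∑ y ∈ (Icc 2 R).filter (fun y => y.minFac = q), Real.log y.minFac / y ≤
      Real.log q / q + Real.exp 5 * Real.log ((R : ℝ) + 1) * (1 / (q : ℝ)) := by
    intro q hq
    have hqp : q.Prime := (Finset.mem_filter.1 hq).2
    have hq2 : (2 : ℝ) ≤ q := by exact_mod_cast hqp.two_le
    have hlogq : 0 < Real.log q := Real.log_pos (by linarith)
    have hre : ∑ y ∈ (Icc 2 R).filter (fun y => y.minFac = q), Real.log y.minFac / y =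
        Real.log q * ∑ y ∈ (Icc 2 R).filter (fun y => y.minFac = q), (1 : ℝ) / y := by
      rw [Finset.mul_sum]
      refine Finset.sum_congr rfl fun y hy => ?_
      rw [(Finset.mem_filter.1 hy).2]; ring
    rw [hre]
    have hf := sum_minFac_fibre_le hqp R
    -- log(R/q + 1) ≤ log(R + 1)
    have hlogle : Real.log (((R / q : ℕ) : ℝ) + 1) ≤ Real.log ((R : ℝ) + 1) := by
      refine Real.log_le_log (by positivity) ?_
      have : ((R / q : ℕ) : ℝ) ≤ R := by exact_mod_cast Nat.div_le_self R q
      linarith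
    calc Real.log q * ∑ y ∈ (Icc 2 R).filter (fun y => y.minFac = q), (1 : ℝ) / y
        ≤ Real.log q * ((1 / (q : ℝ)) * (1 + Real.exp 5 * Real.log (((R / q : ℕ) : ℝ) + 1) / Real.log q)) :=
          mul_le_mul_of_nonneg_left hf hlogq.le
      _ = Real.log q / q + Real.exp 5 * Real.log (((R / q : ℕ) : ℝ) + 1) * (1 / (q : ℝ)) := by
          field_simp
      _ ≤ Real.log q / q + Real.exp 5 * Real.log ((R : ℝ) + 1) * (1 / (q : ℝ)) := by
          have : Real.exp 5 * Real.log (((R / q : ℕ) : ℝ) + 1) ≤ Real.exp 5 * Real.log ((R : ℝ) + 1) :=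
            mul_le_mul_of_nonneg_left hlogle (Real.exp_pos 5).le
          have h0 : (0 : ℝ) ≤ 1 / q := by positivity
          nlinarith
  refine (Finset.sum_le_sum hfib).trans ?_
  rw [Finset.sum_add_distrib, ← Finset.mul_sum]
  -- the two prime sums from the tree
  have hsub1 : Pr ⊆ Nat.primesLE R := by
    intro q hq
    have hq' := Finset.mem_filter.1 hq
    exact Nat.mem_primesLE.2 ⟨(Finset.mem_Icc.1 hq'.1).2, hq'.2⟩
  have h1 : ∑ q ∈ Pr, Real.log q / q ≤ Real.log R + Real.log 4 := by
    refine le_trans ?_ (Literature.NumberTheory.LFunctions.MertensBound.sum_log_div_prime_le R)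
    refine Finset.sum_le_sum_of_subset_of_nonneg hsub1 fun q hq _ => ?_
    have : (1 : ℝ) ≤ q := by exact_mod_cast (Nat.mem_primesLE.1 hq).2.one_lt.le
    exact div_nonneg (Real.log_nonneg this) (by positivity)
  have h2 : ∑ q ∈ Pr, (1 : ℝ) / q ≤ Real.log (Real.log R) + 4 := by
    have h := Literature.NumberTheory.LFunctions.MertensBound.sum_inv_prime_Icc_le (P := (2 : ℝ)) (Q := (R : ℝ))
      (by exact_mod_cast hR)
    have hc : ⌈(2 : ℝ)⌉₊ = 2 := by norm_num
    have hf : ⌊(R : ℝ)⌋₊ = R := Nat.floor_natCast R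
    rw [hc, hf] at h
    exact h
  have he : 0 ≤ Real.exp 5 * Real.log ((R : ℝ) + 1) := by positivity
  calc ∑ q ∈ Pr, Real.log q / q + Real.exp 5 * Real.log ((R : ℝ) + 1) * ∑ q ∈ Pr, (1 : ℝ) / q
      ≤ (Real.log R + Real.log 4) + Real.exp 5 * Real.log ((R : ℝ) + 1) * (Real.log (Real.log R) + 4) :=
        add_le_add h1 (mul_le_mul_of_nonneg_left h2 he)
    _ = _ := by ring

/-- **The energy of PROP. K's flow**: for `R ≥ 2`,
`E_R = Σ_{2≤y≤R} π_y²/(y·log minFac y) ≤ e¹⁰·(log R + log 4 + e⁵·log(R+1)·(log log R + 4))`. -/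
theorem rootEnergy_le {R : ℕ} (hR : 2 ≤ R) :
    ∑ y ∈ Icc 2 R, (∏ q ∈ (y.minFac + 1).primesBelow, (1 - 1 / (q : ℝ))⁻¹) ^ 2 / ((y : ℝ) * Real.log y.minFac) ≤
      Real.exp 10 * (Real.log R + Real.log 4 + Real.exp 5 * Real.log ((R : ℝ) + 1) * (Real.log (Real.log R) + 4)) := by
  have hterm : ∀ y ∈ Icc 2 R, (∏ q ∈ (y.minFac + 1).primesBelow, (1 - 1 / (q : ℝ))⁻¹) ^ 2 /
      ((y : ℝ) * Real.log y.minFac) ≤ Real.exp 10 * (Real.log y.minFac / y) := by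
    intro y hy
    have hy2 := (Finset.mem_Icc.1 hy).1
    have hp : y.minFac.Prime := Nat.minFac_prime (by omega)
    have hlog : 0 < Real.log y.minFac := Real.log_pos (by exact_mod_cast hp.one_lt)
    have hy0 : (0 : ℝ) < y := by exact_mod_cast (show 0 < y by omega)
    have hπ := prod_primesBelow_succ_inv_le hp.two_le
    have hπ0 : 0 ≤ ∏ q ∈ (y.minFac + 1).primesBelow, (1 - 1 / (q : ℝ))⁻¹ :=
      (zero_le_one.trans (one_le_prod_primesBelow_inv' _))
    have hsq : (∏ q ∈ (y.minFac + 1).primesBelow, (1 - 1 / (q : ℝ))⁻¹) ^ 2 ≤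
        (Real.exp 5 * Real.log y.minFac) ^ 2 := pow_le_pow_left₀ hπ0 hπ 2
    calc _ ≤ (Real.exp 5 * Real.log y.minFac) ^ 2 / ((y : ℝ) * Real.log y.minFac) :=
          div_le_div_of_nonneg_right hsq (by positivity)
      _ = Real.exp 10 * (Real.log y.minFac / y) := by
          rw [show Real.exp 10 = Real.exp 5 ^ 2 by rw [← Real.exp_nat_mul]; norm_num]
          field_simp
  refine (Finset.sum_le_sum hterm).trans ?_
  rw [← Finset.mul_sum]
  exact mul_le_mul_of_nonneg_left (sum_log_minFac_div_le hR) (Real.exp_pos 10).le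

end Summit.RiemannHypothesis.RiemannHypothesis.Theorems.IntegerScrew

end
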